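import Literature.AlgebraicGeometry.HodgeTheory.AbelianVarietyIntegralPullbackNewton
import Literature.AlgebraicGeometry.HodgeTheory.AbelianVarietyTopCupProductsDeterminantIndex
import Literature.AlgebraicGeometry.HodgeTheory.AbelianVarietyTopCohomologyOrientations
import Literature.AlgebraicGeometry.HodgeTheory.AbelianVarietyMappingDegreeIsogenyTransfer
import HarnessLib

/-!
# Mumford §19 on the algebraic carrier: `φ ↦ deg φ(ℂ) = det(φ^* | H¹(A(ℂ); ℤ))` is a polynomial function of degree `≤ 2 dim A` on `End(A)`

Layer `Literature/AlgebraicGeometry/HodgeTheory`, namespace `Literature.AlgebraicGeometry.HodgeTheory` (theorems in the `AbelianVariety`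
namespace).  THEOREMS ONLY (no definition, no named fact, no instance, no notation; D-0026 net debt 0).  Sequel of g45-#8
`AbelianVarietyIntegralPullbackHigherCube` and g45-#9 `AbelianVarietyIntegralPullbackNewton`.  For an endomorphism `φ : A ⟶ A` of a complex
abelian variety of dimension `g` the tree knows that the MAPPING DEGREE of `φ(ℂ) : A(ℂ) → A(ℂ)` is `det(φ^* | H¹(A(ℂ); ℤ))`
(`AbelianVariety.hasDegree_det_singularCohomology_map_one`: `φ(ℂ)_*[A(ℂ)]_μ = det(φ^*|H¹) · [A(ℂ)]_μ`; Lange Prop. 1.1.13 (c) «`deg f = det ρ_r(f)`»),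
and that `n ↦ deg(n_A - f)` is the characteristic polynomial of `ρ_r(f)` (`AbelianVarietyRationalCharpoly`, Lange Prop. 2.4.3 (b)).  Here the
statement OFF that line, i.e. Mumford's «`deg` is a polynomial function of degree `2g` on `End X`»: pairing the higher cube identities on
`H^{2g}(A(ℂ); ℤ)` with the fundamental class (`⟨φ^*y, [A]⟩ = ⟨y, φ_*[A]⟩ = deg φ · ⟨y, [A]⟩`, `kroneckerPairing_map`; a class `y₀` with
`⟨y₀, [A]⟩ = 1`, `exists_kroneckerPairing_fundamentalClass_eq_one`) turns them into identities for the integers `det(φ^*|H¹)`.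

THE PRINTS.  D. Mumford, *Abelian Varieties* (1970) [MumfordAV1970] §19 (the degree `End(X) → ℤ` is (the restriction of) a homogeneous
polynomial function of degree `2g`; `deg(n·φ + ψ)` is a polynomial in `n`).  H. Lange, *Abelian Varieties over the Complex Numbers* (2023)
[Lange2023AbelianVarietiesComplex] §1.1.2 Prop. 1.1.13 (c) [held text `book:lange1992-complex-abelian-varieties` p0022 L8–L13] «If `f ∈ End(X)`,
that is `Λ = Λ'`, then `deg f = det ρ_r(f)`», Prop. 1.1.14 «`n_X` is an isogeny of degree `n^{2g}`», §2.4.1 Prop. 2.4.3 (b) «`P^r_f(n) = deg(n_X - f)`».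
E. Bombieri, W. Gubler, *Heights in Diophantine Geometry* (2006) [BombieriGubler2006] §8.6 Lemma 8.6.10, Thm. 8.6.11 (the quadratic case),
§8.7 Prop. 8.7.2 [p0257 L1] «`[n]` is a finite flat surjective morphism of degree `n^{2 dim(A)}`».

## What is proved

For `A : Motives.AbelianVariety ℂ` (`g = A.dim`), endomorphisms `f g₀ : A ⟶ A`, `fᵢ : ι → (A ⟶ A)`; write
`D(φ) = LinearMap.det (singularCohomology.map ℤ ℤ (AlgPoints.mapContinuous (L := ℂ) φ.hom.hom.hom) 1).hom` (`= deg φ(ℂ)`):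

* §1 **`sum_neg_one_pow_card_mul_det_singularCohomology_map_one_eq_zero`** — `2g < |ι|` ⇒ `Σ_{I ⊆ ι} (-1)^{|I|} D(g₀ + Σ_{i∈I} fᵢ) = 0`;
  **`sum_neg_one_pow_card_mul_eq_zero_of_hasDegree`** — the same for the mapping degrees `deg_μ (g₀ + Σ_{i∈I} fᵢ)(ℂ)` w.r.t. any integral
  orientation `μ` of `A(ℂ)`;
* §2 **`fwdDiff_iter_det_singularCohomology_map_one_eq_zero`** — `(fwdDiff f)^[2g+1] D g₀ = 0`;
  **`det_singularCohomology_map_add_nsmul_one_eq_sum_choose_smul_fwdDiff_iter`** — `D(g₀ + n·f) = Σ_{k ≤ 2g} C(n,k) · (fwdDiff f)^[k] D g₀` for all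
  `n : ℕ`: `n ↦ deg(g₀ + n·f)` is a polynomial of degree `≤ 2g` in `n`.

## References

* [MumfordAV1970] D. Mumford, *Abelian Varieties*, 1970 — §19.
* [Lange2023AbelianVarietiesComplex] H. Lange, *Abelian Varieties over the Complex Numbers*, Springer 2023 — §1.1.2 Prop. 1.1.13 (c), Prop. 1.1.14;
  §2.4.1 Prop. 2.4.3 (b).
* [BombieriGubler2006] E. Bombieri, W. Gubler, *Heights in Diophantine Geometry*, CUP 2006 — §8.6 Lemma 8.6.10, Thm. 8.6.11; §8.7 Prop. 8.7.2.
* [HatcherAT2002] A. Hatcher, *Algebraic Topology*, CUP 2002 — §3.3 (degree, Kronecker pairing).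

## Provenance

lit-hodgefound prover seat p21, generation 45, row g45-#10 (own row, claimed by path; sequel of g45-#8 and g45-#9).
-/

noncomputable section

open Function CategoryTheory
open Literature.AlgebraicTopology.SingularHomology
open Literature.AlgebraicGeometry.Motives

universe u v w

namespace Literature.AlgebraicGeometry.HodgeTheory

namespace AbelianVariety

/-! ### §0 Plumbing -/

section Plumbing

/-- Plumbing: iterated forward differences commute with post-composition by an additive map. [folklore] -/
private theorem iterate_fwdDiff_comp' {M : Type u} {G : Type v} {G' : Type w} [AddCommMonoid M] [AddCommGroup G] [AddCommGroup G']
    (L : G →+ G') (h : M) (F : M → G) (k : ℕ) : (fwdDiff h)^[k] (⇑L ∘ F) = ⇑L ∘ (fwdDiff h)^[k] F := by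
  induction k with
  | zero => rfl
  | succ k ih =>
    rw [Function.iterate_succ_apply', Function.iterate_succ_apply', ih]
    funext x
    simp only [fwdDiff, Function.comp_apply, map_sub]

end Plumbing

variable {A : Motives.AbelianVariety ℂ}

/-- Plumbing: **`⟨φ^* y, [A(ℂ)]_μ⟩ = det(φ^*|H¹) · ⟨y, [A(ℂ)]_μ⟩`** for every continuous self-map `φ` of `A(ℂ)` and `y ∈ H^{2g}(A(ℂ); ℤ)`
(naturality of the Kronecker pairing and `φ_*[A(ℂ)]_μ = det(φ^*|H¹) · [A(ℂ)]_μ`). [cite: Lange2023AbelianVarietiesComplex, §1.1.2 Prop. 1.1.13 (c)]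
[cite: HatcherAT2002, §3.3 Thm. 3.26 and Exercises 7–8] -/
private theorem kroneckerPairing_map_fundamentalClass' (μ : HomologicalOrientation ℤ (ComplexPoints A.X) (2 * A.dim))
    (φ : C(ComplexPoints A.X, ComplexPoints A.X)) (y : singularCohomology ℤ ℤ (ComplexPoints A.X) (2 * A.dim)) :
    kroneckerPairing ℤ ℤ (ComplexPoints A.X) (2 * A.dim) (singularCohomology.map ℤ ℤ φ (2 * A.dim) y) μ.fundamentalClass =
      LinearMap.det (singularCohomology.map ℤ ℤ φ 1).hom * kroneckerPairing ℤ ℤ (ComplexPoints A.X) (2 * A.dim) y μ.fundamentalClass := by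
  have hd := hasDegree_det_singularCohomology_map_one A φ μ
  rw [HasDegree] at hd
  rw [kroneckerPairing_map, hd, map_zsmul, zsmul_eq_mul, Int.cast_id]

/-! ### §1 The higher cube identities for the degree -/

/-- **MUMFORD §19 ON `End(A)`: `φ ↦ deg φ(ℂ) = det(φ^* | H¹(A(ℂ); ℤ))` is a polynomial function of degree `≤ 2g`** — for `2g < |ι|` endomorphisms
`fᵢ : A ⟶ A` and any `g₀ : A ⟶ A`, `Σ_{I ⊆ ι} (-1)^{|I|} det((g₀ + Σ_{i∈I} fᵢ)^* | H¹(A(ℂ); ℤ)) = 0` (all `(2g+1)`-fold mixed differences of the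
degree vanish): the higher cube identity on `H^{2g}(A(ℂ); ℤ)` (g45-#8) applied to a class `y₀` with `⟨y₀, [A(ℂ)]⟩ = 1` and paired with `[A(ℂ)]`.
[cite: MumfordAV1970, §19] [cite: Lange2023AbelianVarietiesComplex, §1.1.2 Prop. 1.1.13 (c)]
[cite: BombieriGubler2006, §8.6 Lemma 8.6.10 and Thm. 8.6.11] -/
theorem sum_neg_one_pow_card_mul_det_singularCohomology_map_one_eq_zero {ι : Type} [Fintype ι] [DecidableEq ι]
    (hι : 2 * A.dim < Fintype.card ι) (g₀ : A ⟶ A) (f : ι → (A ⟶ A)) :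
    ∑ I : Finset ι, (-1 : ℤ) ^ I.card *
      LinearMap.det (singularCohomology.map ℤ ℤ (AlgPoints.mapContinuous (L := ℂ) (g₀ + ∑ i ∈ I, f i).hom.hom.hom) 1).hom = 0 := by
  let μ := complexOrientationInt (AbelianVariety.isSmoothProjective_holds (A := A))
  obtain ⟨y₀, hy₀⟩ := exists_kroneckerPairing_fundamentalClass_eq_one A μ
  have h := singularCohomology_int_map_sum_neg_one_pow_card_smul_map_add_sum hι g₀ f y₀
  calc ∑ I : Finset ι, (-1 : ℤ) ^ I.card *
        LinearMap.det (singularCohomology.map ℤ ℤ (AlgPoints.mapContinuous (L := ℂ) (g₀ + ∑ i ∈ I, f i).hom.hom.hom) 1).hom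
      = ∑ I : Finset ι, (kroneckerPairing ℤ ℤ (ComplexPoints A.X) (2 * A.dim)).flip μ.fundamentalClass ((-1 : ℤ) ^ I.card •
          singularCohomology.map ℤ ℤ (AlgPoints.mapContinuous (L := ℂ) (g₀ + ∑ i ∈ I, f i).hom.hom.hom) (2 * A.dim) y₀) :=
        Finset.sum_congr rfl fun I _ ↦ by
          rw [map_zsmul, LinearMap.flip_apply, kroneckerPairing_map_fundamentalClass', hy₀, mul_one, zsmul_eq_mul, Int.cast_id]
    _ = 0 := by rw [← map_sum, h, map_zero]

/-- **The same at the base point `0`**: `Σ_{I ⊆ ι} (-1)^{|I|} det((Σ_{i∈I} fᵢ)^* | H¹(A(ℂ); ℤ)) = 0` for `2g < |ι|` endomorphisms.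
[cite: MumfordAV1970, §19] [cite: Lange2023AbelianVarietiesComplex, §1.1.2 Prop. 1.1.13 (c)] -/
theorem sum_neg_one_pow_card_mul_det_singularCohomology_map_sum_one_eq_zero {ι : Type} [Fintype ι] [DecidableEq ι]
    (hι : 2 * A.dim < Fintype.card ι) (f : ι → (A ⟶ A)) :
    ∑ I : Finset ι, (-1 : ℤ) ^ I.card *
      LinearMap.det (singularCohomology.map ℤ ℤ (AlgPoints.mapContinuous (L := ℂ) (∑ i ∈ I, f i).hom.hom.hom) 1).hom = 0 := by
  have h := sum_neg_one_pow_card_mul_det_singularCohomology_map_one_eq_zero hι 0 f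
  refine Eq.trans (Finset.sum_congr rfl fun I _ ↦ ?_) h
  rw [zero_add]

/-- **The higher cube identity for MAPPING DEGREES: if `2g < |ι|` and `deg_I` is the degree of `(g₀ + Σ_{i∈I} fᵢ)(ℂ) : A(ℂ) → A(ℂ)` w.r.t. an
integral orientation `μ` (`(g₀ + Σ_{i∈I} fᵢ)(ℂ)_* [A(ℂ)]_μ = deg_I · [A(ℂ)]_μ`), then `Σ_{I ⊆ ι} (-1)^{|I|} deg_I = 0`.**
[cite: MumfordAV1970, §19] [cite: Lange2023AbelianVarietiesComplex, §1.1.2 Prop. 1.1.13 (c) and Prop. 1.1.14] [cite: HatcherAT2002, §3.3 Exercises 7–8] -/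
theorem sum_neg_one_pow_card_mul_eq_zero_of_hasDegree {ι : Type} [Fintype ι] [DecidableEq ι] (hι : 2 * A.dim < Fintype.card ι)
    (μ : HomologicalOrientation ℤ (ComplexPoints A.X) (2 * A.dim)) (g₀ : A ⟶ A) (f : ι → (A ⟶ A)) (deg : Finset ι → ℤ)
    (hdeg : ∀ I, HasDegree μ μ (AlgPoints.mapContinuous (L := ℂ) (g₀ + ∑ i ∈ I, f i).hom.hom.hom) (deg I)) :
    ∑ I : Finset ι, (-1 : ℤ) ^ I.card * deg I = 0 := by
  refine Eq.trans (Finset.sum_congr rfl fun I _ ↦ ?_) (sum_neg_one_pow_card_mul_det_singularCohomology_map_one_eq_zero hι g₀ f)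
  rw [eq_of_hasDegree_of_hasDegree A μ μ _ (hdeg I) (hasDegree_det_singularCohomology_map_one A _ μ)]

/-! ### §2 Newton form: `n ↦ deg(g₀ + n·f)` is a polynomial of degree `≤ 2g` -/

/-- **`Δ_f^{2g+1} (φ ↦ det(φ^*|H¹(A(ℂ); ℤ))) ≡ 0` on `End(A)`**: the `(2g+1)`-st forward difference, with any step `f`, of the degree function
vanishes identically. [cite: MumfordAV1970, §19] [cite: Lange2023AbelianVarietiesComplex, §1.1.2 Prop. 1.1.13 (c)] -/
theorem fwdDiff_iter_det_singularCohomology_map_one_eq_zero (f g₀ : A ⟶ A) :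
    (fwdDiff f)^[2 * A.dim + 1]
      (fun φ : A ⟶ A ↦ LinearMap.det (singularCohomology.map ℤ ℤ (AlgPoints.mapContinuous (L := ℂ) φ.hom.hom.hom) 1).hom) g₀ = 0 := by
  let μ := complexOrientationInt (AbelianVariety.isSmoothProjective_holds (A := A))
  obtain ⟨y₀, hy₀⟩ := exists_kroneckerPairing_fundamentalClass_eq_one A μ
  have hD : (fun φ : A ⟶ A ↦ LinearMap.det (singularCohomology.map ℤ ℤ (AlgPoints.mapContinuous (L := ℂ) φ.hom.hom.hom) 1).hom) =
      ⇑((kroneckerPairing ℤ ℤ (ComplexPoints A.X) (2 * A.dim)).flip μ.fundamentalClass).toAddMonoidHom ∘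
        fun φ : A ⟶ A ↦ singularCohomology.map ℤ ℤ (AlgPoints.mapContinuous (L := ℂ) φ.hom.hom.hom) (2 * A.dim) y₀ := by
    funext φ
    rw [Function.comp_apply, LinearMap.toAddMonoidHom_coe, LinearMap.flip_apply, kroneckerPairing_map_fundamentalClass', hy₀, mul_one]
  rw [hD, iterate_fwdDiff_comp', Function.comp_apply, singularCohomology_int_map_fwdDiff_iter_eq_zero, map_zero]

/-- **GREGORY–NEWTON FOR THE DEGREE: `det((g₀ + n·f)^*|H¹(A(ℂ); ℤ)) = Σ_{k=0}^{2g} C(n,k) · Δ_f^k(φ ↦ det(φ^*|H¹))(g₀)` for every `n : ℕ`** —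
`n ↦ deg(g₀ + n·f)` is a polynomial of degree `≤ 2g = 2 dim A` in `n` (off the line `n_A - f` of the characteristic polynomial
`P^r_f(n) = deg(n_A - f)`). [cite: MumfordAV1970, §19] [cite: Lange2023AbelianVarietiesComplex, §1.1.2 Prop. 1.1.13 (c) and §2.4.1 Prop. 2.4.3 (b)]
[cite: BombieriGubler2006, §8.7 Prop. 8.7.2] -/
theorem det_singularCohomology_map_add_nsmul_one_eq_sum_choose_smul_fwdDiff_iter (f g₀ : A ⟶ A) (n : ℕ) :
    LinearMap.det (singularCohomology.map ℤ ℤ (AlgPoints.mapContinuous (L := ℂ) (g₀ + n • f).hom.hom.hom) 1).hom =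
      ∑ k ∈ Finset.range (2 * A.dim + 1), n.choose k • (fwdDiff f)^[k]
        (fun φ : A ⟶ A ↦ LinearMap.det (singularCohomology.map ℤ ℤ (AlgPoints.mapContinuous (L := ℂ) φ.hom.hom.hom) 1).hom) g₀ := by
  let μ := complexOrientationInt (AbelianVariety.isSmoothProjective_holds (A := A))
  obtain ⟨y₀, hy₀⟩ := exists_kroneckerPairing_fundamentalClass_eq_one A μ
  have hD : (fun φ : A ⟶ A ↦ LinearMap.det (singularCohomology.map ℤ ℤ (AlgPoints.mapContinuous (L := ℂ) φ.hom.hom.hom) 1).hom) =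
      ⇑((kroneckerPairing ℤ ℤ (ComplexPoints A.X) (2 * A.dim)).flip μ.fundamentalClass).toAddMonoidHom ∘
        fun φ : A ⟶ A ↦ singularCohomology.map ℤ ℤ (AlgPoints.mapContinuous (L := ℂ) φ.hom.hom.hom) (2 * A.dim) y₀ := by
    funext φ
    rw [Function.comp_apply, LinearMap.toAddMonoidHom_coe, LinearMap.flip_apply, kroneckerPairing_map_fundamentalClass', hy₀, mul_one]
  have h := congrArg ((kroneckerPairing ℤ ℤ (ComplexPoints A.X) (2 * A.dim)).flip μ.fundamentalClass)
    (singularCohomology_int_map_add_nsmul_eq_sum_choose_smul_fwdDiff_iter f g₀ (2 * A.dim) n y₀)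
  rw [LinearMap.flip_apply, kroneckerPairing_map_fundamentalClass', hy₀, mul_one, map_sum] at h
  refine h.trans (Finset.sum_congr rfl fun k _ ↦ ?_)
  rw [map_nsmul, hD, iterate_fwdDiff_comp', Function.comp_apply, LinearMap.toAddMonoidHom_coe]

end AbelianVariety

end Literature.AlgebraicGeometry.HodgeTheory

end
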